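import Mathlib
import HarnessLib
import Literature.Computability.AlgebraicComplexity.AsymptoticSpectrum
import Literature.Computability.AlgebraicComplexity.BorderRankCW
import Literature.Computability.AlgebraicComplexity.SchoenhageTau

/-!
# An exact instance of strict submultiplicativity of border rank under the Kronecker product:
# `bR(W ⊠ T_CGJ) ≤ 9 < 10 = bR(W) · bR(T_CGJ)`

`W = T_{cw,1} = e₀⊗e₁⊗e₁ + e₁⊗e₀⊗e₁ + e₁⊗e₁⊗e₀` is the W-state (the little Coppersmith–Winograd tensor
with `q = 1`, border rank `2`, rank `3`) and
`T_CGJ = a₁b₁c₁ + a₂b₂c₂ + a₃b₃c₃ + (a₁+a₂+a₃)(b₁+b₂+b₃)(c₁+c₂+c₃) + 2(a₁+a₂)(b₁+b₃)(c₂+c₃) ∈ ℚ³⊗ℚ³⊗ℚ³`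
is the tensor of Christandl–Gesmundo–Jensen, *Border rank is not multiplicative under the tensor
product* (SIAM J. Appl. Algebra Geom. 3 (2019), Prop. 3.1), which has rank = border rank `5` and sits on
a secant line with a double drop: `T − 2Z` and `T − Z` have rank `4` for the rank-one
`Z = (a₁+a₂)(b₁+b₃)(c₂+c₃)`.

MECHANISM. If `z` is rank one and `q₀`, `q₁ = q₀ + z` have (border) rank `≤ r`, then for `p = q₀ + 2z`
`W ⊠ p = lim_{ε→0} ε⁻¹ [ (e₁+εe₀)^{⊗3} ⊠ q₀ + (e₁+2εe₀)^{⊗3} ⊠ z − e₁^{⊗3} ⊠ q₁ ]`,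
so `bR(W ⊠ p) ≤ 2r + 1 < 2(r+1)`. With the honest rank-`4` decompositions of `T − 2Z` and `T − Z` this
is an explicit ORDER-ONE approximate decomposition with NINE triads over `ℚ[ε]`, recorded below as the
tables `u0/u1, v0/v1, w0/w1` (index `(w, i) ∈ Fin 2 × Fin 3` of `ℚ² ⊗ ℚ³`; degree-`0` parts live in the
block `w = 1`, degree-`1` parts in the block `w = 0`).  The two coefficient identities (`ε⁰`: zero;
`ε¹`: `W ⊠ T_CGJ`) are checked by `decide` over `ℤ` on the tables scaled by `2` (every triad then carries a factor `8`) and transported to `ℚ`.  (The matching lower bound `bR ≥ 9` — a Koszul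
flattening of rank `18` after a generic rank-`3` restriction of one leg — is recorded in the decomp-mm
census, `census/data/k13e-exact-certificate-WxTcgj-v6.json`, not formalised here.)

Provenance: decomp-mm census generation 6 (instrument cell K7-A «bR(W ⊠ u) = 9 < 10» made exact).
-/

open Literature.Computability.AlgebraicComplexity
open scoped BigOperators Polynomial

set_option linter.dupNamespace false -- `MatrixMultiplication.MatrixMultiplication` (summit = problem, D-0017)

namespace Summit.MatrixMultiplication.MatrixMultiplication.Theorems.KroneckerWStateBorderRank

/-- The Christandl–Gesmundo–Jensen tensor over `ℤ`: entry `[i=j=k] + 1 + 2·[i ≠ 2][j ≠ 1][k ≠ 0]`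
(`T_CGJ = Σᵢ aᵢbᵢcᵢ + (Σa)(Σb)(Σc) + 2(a₁+a₂)(b₁+b₃)(c₂+c₃)`, CGJ 2019 Prop. 3.1, 0-based indices). [cite: ChristandlGesmundoJensen2019, Prop. 3.1] -/
def tCGJInt : Fin 3 → Fin 3 → Fin 3 → ℤ := fun i j k =>
  (if i = j ∧ j = k then 1 else 0) + 1 + (if i ≠ 2 ∧ j ≠ 1 ∧ k ≠ 0 then 2 else 0)

/-- `T_CGJ` over `ℚ`. [cite: ChristandlGesmundoJensen2019, Prop. 3.1] -/
def tCGJ : Fin 3 → Fin 3 → Fin 3 → ℚ := fun i j k => (tCGJInt i j k : ℚ)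

/-- cast `ℤ → ℚ` of the host `W ⊠ T_CGJ`. [folklore] -/
theorem intCast_host (a b c : Fin 2 × Fin 3) :
    ((kroneckerTensor (cwTensor ℤ 1) tCGJInt a b c : ℤ) : ℚ) = kroneckerTensor (cwTensor ℚ 1) tCGJ a b c := by
  simp only [kroneckerTensor_apply, cwTensor_apply, tCGJ, Int.cast_mul]
  split_ifs <;> simp

/-- `2 ×` degree-`0` parts of the first factors (all in the `e₁`-block; the sign of the four `q`-terms folded in) (scaled by `2`, integral). [new] -/
def U0 : Fin 9 → Fin 2 × Fin 3 → ℤ := fun ρ p =>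
  match ρ, p.1, p.2 with
  | 0, 1, 0 => 2
  | 1, 1, 1 => 2
  | 2, 1, 2 => 2
  | 3, 1, 0 => 2
  | 3, 1, 1 => 2
  | 3, 1, 2 => 2
  | 4, 1, 0 => 2
  | 4, 1, 1 => 2
  | 5, 1, 0 => -4
  | 5, 1, 1 => -4
  | 5, 1, 2 => -2
  | 6, 1, 1 => -2
  | 6, 1, 2 => -1
  | 7, 1, 0 => -2
  | 7, 1, 2 => -1
  | 8, 1, 2 => -2
  | _, _, _ => 0

/-- `2 ×` degree-`1` parts of the first factors (all in the `e₀`-block) (scaled by `2`, integral). [new] -/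
def U1 : Fin 9 → Fin 2 × Fin 3 → ℤ := fun ρ p =>
  match ρ, p.1, p.2 with
  | 0, 0, 0 => 2
  | 1, 0, 1 => 2
  | 2, 0, 2 => 2
  | 3, 0, 0 => 2
  | 3, 0, 1 => 2
  | 3, 0, 2 => 2
  | 4, 0, 0 => 4
  | 4, 0, 1 => 4
  | _, _, _ => 0

/-- `2 ×` degree-`0` parts of the second factors (scaled by `2`, integral). [new] -/
def V0 : Fin 9 → Fin 2 × Fin 3 → ℤ := fun ρ p =>
  match ρ, p.1, p.2 with
  | 0, 1, 0 => 2
  | 1, 1, 1 => 2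
  | 2, 1, 2 => 2
  | 3, 1, 0 => 2
  | 3, 1, 1 => 2
  | 3, 1, 2 => 2
  | 4, 1, 0 => 2
  | 4, 1, 2 => 2
  | 5, 1, 0 => 2
  | 5, 1, 1 => 1
  | 5, 1, 2 => 2
  | 6, 1, 1 => 2
  | 7, 1, 0 => 2
  | 7, 1, 1 => 1
  | 8, 1, 1 => 1
  | 8, 1, 2 => 2
  | _, _, _ => 0

/-- `2 ×` degree-`1` parts of the second factors (scaled by `2`, integral). [new] -/
def V1 : Fin 9 → Fin 2 × Fin 3 → ℤ := fun ρ p =>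
  match ρ, p.1, p.2 with
  | 0, 0, 0 => 2
  | 1, 0, 1 => 2
  | 2, 0, 2 => 2
  | 3, 0, 0 => 2
  | 3, 0, 1 => 2
  | 3, 0, 2 => 2
  | 4, 0, 0 => 4
  | 4, 0, 2 => 4
  | _, _, _ => 0

/-- `2 ×` degree-`0` parts of the third factors (scaled by `2`, integral). [new] -/
def W0 : Fin 9 → Fin 2 × Fin 3 → ℤ := fun ρ p =>
  match ρ, p.1, p.2 with
  | 0, 1, 0 => 2
  | 1, 1, 1 => 2
  | 2, 1, 2 => 2
  | 3, 1, 0 => 2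
  | 3, 1, 1 => 2
  | 3, 1, 2 => 2
  | 4, 1, 1 => 2
  | 4, 1, 2 => 2
  | 5, 1, 0 => 1
  | 5, 1, 1 => 2
  | 5, 1, 2 => 2
  | 6, 1, 0 => 1
  | 6, 1, 1 => 2
  | 7, 1, 0 => 2
  | 8, 1, 0 => 1
  | 8, 1, 2 => 2
  | _, _, _ => 0

/-- `2 ×` degree-`1` parts of the third factors (scaled by `2`, integral). [new] -/
def W1 : Fin 9 → Fin 2 × Fin 3 → ℤ := fun ρ p =>
  match ρ, p.1, p.2 with
  | 0, 0, 0 => 2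
  | 1, 0, 1 => 2
  | 2, 0, 2 => 2
  | 3, 0, 0 => 2
  | 3, 0, 1 => 2
  | 3, 0, 2 => 2
  | 4, 0, 1 => 4
  | 4, 0, 2 => 4
  | _, _, _ => 0

set_option maxRecDepth 4000 in
/-- the `ε⁰`-coefficient of the nine-triad family vanishes identically (kernel check over `ℤ`). [new] -/
theorem identity_zero : ∀ (a b c : Fin 2 × Fin 3),
    (∑ ρ : Fin 9, U0 ρ a * V0 ρ b * W0 ρ c) = 0 := by
  decide

set_option maxRecDepth 4000 in
/-- the `ε¹`-coefficient of the nine-triad family is `8 · (W ⊠ T_CGJ)` (tables scaled by `2`; kernel check over `ℤ`). [new] -/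
theorem identity_one : ∀ (a b c : Fin 2 × Fin 3),
    (∑ ρ : Fin 9, (U1 ρ a * V0 ρ b * W0 ρ c + U0 ρ a * V1 ρ b * W0 ρ c + U0 ρ a * V0 ρ b * W1 ρ c)) =
      8 * kroneckerTensor (cwTensor ℤ 1) tCGJInt a b c := by
  decide

/-- first factors `u_ρ(ε) = (U0_ρ + ε U1_ρ)/2`. [new] -/
noncomputable def uP (ρ : Fin 9) (a : Fin 2 × Fin 3) : ℚ[X] :=
  Polynomial.C ((U0 ρ a : ℚ) / 2) + Polynomial.X * Polynomial.C ((U1 ρ a : ℚ) / 2)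

/-- second factors `v_ρ(ε) = (V0_ρ + ε V1_ρ)/2`. [new] -/
noncomputable def vP (ρ : Fin 9) (b : Fin 2 × Fin 3) : ℚ[X] :=
  Polynomial.C ((V0 ρ b : ℚ) / 2) + Polynomial.X * Polynomial.C ((V1 ρ b : ℚ) / 2)

/-- third factors `w_ρ(ε) = (W0_ρ + ε W1_ρ)/2`. [new] -/
noncomputable def wP (ρ : Fin 9) (c : Fin 2 × Fin 3) : ℚ[X] :=
  Polynomial.C ((W0 ρ c : ℚ) / 2) + Polynomial.X * Polynomial.C ((W1 ρ c : ℚ) / 2)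

/-- degree-`≤ 3` expansion of one triad of linear polynomials. [folklore] -/
theorem triad_expand (x0 x1 y0 y1 z0 z1 : ℚ) :
    (Polynomial.C x0 + Polynomial.X * Polynomial.C x1) * (Polynomial.C y0 + Polynomial.X * Polynomial.C y1) *
        (Polynomial.C z0 + Polynomial.X * Polynomial.C z1) =
      Polynomial.C (x0 * y0 * z0) + Polynomial.C (x1 * y0 * z0 + x0 * y1 * z0 + x0 * y0 * z1) * Polynomial.X +
        Polynomial.C (x1 * y1 * z0 + x1 * y0 * z1 + x0 * y1 * z1) * Polynomial.X ^ 2 +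
          Polynomial.C (x1 * y1 * z1) * Polynomial.X ^ 3 := by
  simp only [map_mul, map_add]
  ring

/-- its `ε⁰`-coefficient. [folklore] -/
theorem triad_coeff_zero (x0 x1 y0 y1 z0 z1 : ℚ) :
    ((Polynomial.C x0 + Polynomial.X * Polynomial.C x1) * (Polynomial.C y0 + Polynomial.X * Polynomial.C y1) *
        (Polynomial.C z0 + Polynomial.X * Polynomial.C z1)).coeff 0 = x0 * y0 * z0 := by
  rw [triad_expand]
  simp only [Polynomial.coeff_add, Polynomial.coeff_C_zero, Polynomial.coeff_C_mul_X,
    Polynomial.coeff_C_mul_X_pow]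
  simp

/-- its `ε¹`-coefficient. [folklore] -/
theorem triad_coeff_one (x0 x1 y0 y1 z0 z1 : ℚ) :
    ((Polynomial.C x0 + Polynomial.X * Polynomial.C x1) * (Polynomial.C y0 + Polynomial.X * Polynomial.C y1) *
        (Polynomial.C z0 + Polynomial.X * Polynomial.C z1)).coeff 1 = x1 * y0 * z0 + x0 * y1 * z0 + x0 * y0 * z1 := by
  rw [triad_expand]
  simp only [Polynomial.coeff_add, Polynomial.coeff_C, Polynomial.coeff_C_mul_X,
    Polynomial.coeff_C_mul_X_pow]
  simp

/-- the `ε⁰`-identity transported to `ℚ` with the halves. [new] -/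
theorem rat_identity_zero (a b c : Fin 2 × Fin 3) :
    (∑ ρ : Fin 9, (U0 ρ a : ℚ) / 2 * ((V0 ρ b : ℚ) / 2) * ((W0 ρ c : ℚ) / 2)) = 0 := by
  have h := congrArg (fun z : ℤ => (z : ℚ) / 8) (identity_zero a b c)
  simp only [Int.cast_sum, Int.cast_mul, Int.cast_zero, zero_div, Finset.sum_div] at h
  rw [← h]
  exact Finset.sum_congr rfl fun ρ _ => by ring

/-- the `ε¹`-identity transported to `ℚ` with the halves. [new] -/
theorem rat_identity_one (a b c : Fin 2 × Fin 3) :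
    (∑ ρ : Fin 9, ((U1 ρ a : ℚ) / 2 * ((V0 ρ b : ℚ) / 2) * ((W0 ρ c : ℚ) / 2) +
        (U0 ρ a : ℚ) / 2 * ((V1 ρ b : ℚ) / 2) * ((W0 ρ c : ℚ) / 2) +
        (U0 ρ a : ℚ) / 2 * ((V0 ρ b : ℚ) / 2) * ((W1 ρ c : ℚ) / 2))) =
      kroneckerTensor (cwTensor ℚ 1) tCGJ a b c := by
  have h := congrArg (fun z : ℤ => (z : ℚ) / 8) (identity_one a b c)
  simp only [Int.cast_sum, Int.cast_mul, Int.cast_add, Int.cast_ofNat, intCast_host, Finset.sum_div] at h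
  rw [mul_div_assoc] at h
  rw [show (8 : ℚ) * (kroneckerTensor (cwTensor ℚ 1) tCGJ a b c / 8) = kroneckerTensor (cwTensor ℚ 1) tCGJ a b c by ring] at h
  rw [← h]
  exact Finset.sum_congr rfl fun ρ _ => by ring

/-- **The nine triads are an order-`1` approximate decomposition of `W ⊠ T_CGJ`**
(Bläser 2013, Def. 6.1 grammar `IsApproxDecomposition`). [new] -/
theorem isApproxDecomposition :
    IsApproxDecomposition 1 (kroneckerTensor (cwTensor ℚ 1) tCGJ) uP vP wP := by
  intro a b c j hj
  rw [Polynomial.finsetSum_coeff]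
  rcases Nat.le_one_iff_eq_zero_or_eq_one.mp hj with rfl | rfl
  · simp only [uP, vP, wP, triad_coeff_zero]
    rw [if_neg (by decide)]
    exact rat_identity_zero a b c
  · simp only [uP, vP, wP, triad_coeff_one, if_true]
    exact rat_identity_one a b c

/-- **`bR(W ⊠ T_CGJ) ≤ 9`** — strictly below `bR(W) · bR(T_CGJ) = 2 · 5 = 10`: an exact, rational
instance of strict submultiplicativity of border rank under the Kronecker product in `ℚ⁶ ⊗ ℚ⁶ ⊗ ℚ⁶`. [new] -/
theorem algBorderRank_wState_kronecker_tCGJ_le :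
    algBorderRank (kroneckerTensor (cwTensor ℚ 1) tCGJ) ≤ 9 :=
  (algBorderRank_le_approxRank 1 _).trans (approxRank_le_of_isApproxDecomposition isApproxDecomposition)

end Summit.MatrixMultiplication.MatrixMultiplication.Theorems.KroneckerWStateBorderRank
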